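import Summits.Ventures.LatticeQCDFlow.Scoring.ParityLegConfidence
import Summits.Ventures.LatticeQCDFlow.Exactness.IMHTauIntParityTwoSided
import Summits.Ventures.LatticeQCDFlow.Exactness.FlowESSTargetSideParity
import HarnessLib

/-!
# The parity leg from finitely many draws, II: the `τ_int` column and the ESS column of an
# A-vs-B table with a confidence level

HONEST FRAMING: exact (Metropolis-corrected) sampling algorithms for lattice gauge theory;
figures of merit are autocorrelation/cost numbers at stated couplings and volumes; no
continuum-physics claim.

Venture `LatticeQCDFlow` (cell pub-lqcd), topic `Scoring`; FANOUT row 4 (`s0-u1-b`, rung S0-B: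
two independent codes A, B for the 2D U(1) flow sampler).  Sequel of
`Scoring/ParityLegConfidence.lean` (same row, same day), which turned independent MODEL draws into
Hoeffding certificates for the masses of the parity-failure set `E` and composed the ACCEPTANCE
column.  Here the two remaining columns are composed with their deterministic laws:

* the `τ_int` column with the SYMMETRIC law of `Exactness/IMHTauIntParityTwoSided.lean`
  (`abs_tauInt_sub_le_of_logParityOff_of_weightBounds`: under weight ceilings `w ≤ C q`,
  `w ≤ C' q'` and parity `δ` off `E`, `|τ − τ'| ≤ (e^{δ} − 1)(min(τ,τ') + ½) +
  e^{−δ}·4(B·max(C,C')/Z)²·(∫_E w)/∫ g² w`), whose only unknown is the TARGET mass `∫_E w/Z`,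
  a model mean of the bounded score `1_E·w/(Z q) ∈ [0, C/Z]`
  (`ParityLeg.targetMass_le_weightedFreq_confidence`);
* the ESS column with the target-side law of `Exactness/FlowESSTargetSideParity.lean`
  (`abs_inv_integral_sq_div_sub_le_of_logParityOff`: `|ESS − ESS'| ≤ (e^{δ} − 1)·ESS' + ∫_E p²/q
  + ∫_E p²/q'`, `ESS = (∫ p²/q)⁻¹ ≤ 1`), whose unknowns `∫_E p²/q`, `∫_E p²/q'` are model means of
  the bounded scores `1_E·(p/q)² ∈ [0, W²]`, `1_E·(p/q')² ∈ [0, W'²]` under each code's own draws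
  (`ParityLeg.sqWeightMass_le_weightedFreq_confidence`).

NEW WORK of the cell (elementary compositions); the one cited fact behind it is Hoeffding 1963
Thm. 2 (tree: `Literature.Probability.Moments.measureReal_le_sum_le_exp_of_integral_le`); no
definition is introduced.

## What is proved

* **`tauInt_parityLeg_confidence`** — setting of `IMHTauIntParityTwoSided` (`(X, μ)` s-finite,
  `w > 0` measurable integrable, `Z = ∫ w`, `q, q' > 0` normalised, ceilings `w ≤ C q`, `w ≤ C' q'`,
  parity `δ` off a measurable `E`, `g` measurable, `|g| ≤ B`, `∫ g w = 0`, `A = ∫ g² w > 0`,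
  `τ, τ'` the two integrated autocorrelation times); LEG: independent draws `xᵢ` (`i ∈ s`,
  `n = #s ≥ 1`) from `q`, importance-weighted failure sum `Π̂ = Σ 1_E(xᵢ)·w(xᵢ)/(Z q(xᵢ))`;
  `t ≥ 0`.  Then
  `P( (e^{δ} − 1)(min(τ,τ') + ½) + e^{−δ}·4(B·max(C,C')/Z)²·Z(Π̂/n + t)/A < |τ − τ'| )
  ≤ exp(−2 n t² Z²/C²)`.
* `integrable_sq_div_of_weightBound` — `0 ≤ p ≤ W q`, `p` integrable, `q > 0` ⇒ `p²/q` integrable.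
* **`ess_parityLeg_confidence`** — `p ≥ 0` normalised target, `q, q' > 0` normalised models with
  ceilings `p ≤ W q`, `p ≤ W' q'`, parity `δ ≥ 0` off a measurable `E`; LEGS: independent draws
  `xᵢ` (`i ∈ s`, `n ≥ 1`) from `q` with `Σ̂ = Σ 1_E(xᵢ)(p/q)²(xᵢ)`, independent draws `x'ⱼ`
  (`j ∈ s'`, `n' ≥ 1`) from `q'` with `Σ̂'` likewise; `t, t' ≥ 0`.  Then
  `P( (e^{δ} − 1) + (Σ̂/n + t) + (Σ̂'/n' + t') < |ESS − ESS'| ) ≤ exp(−2nt²/W⁴) + exp(−2n't'²/W'⁴)`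
  (`ESS = (∫ p²/q dμ)⁻¹`, `ESS' = (∫ p²/q' dμ)⁻¹`).

Reading for row 4 (value-free; no number of ours, no sealed value): with each arm's weight ceiling
certified, ONE leg of `n` independent model draws per code — the proposals the flow produces anyway
— with the other code's log-density evaluated on them, yields for all three leaderboard columns an
explicit discrepancy threshold that the two codes can exceed only with a stated, exponentially
small probability: failure COUNTS for the acceptance column (part I), importance-WEIGHTED failures
for `τ_int` (target mass, rate `Z²/C² = 1/W²`), SQUARED-weight failures for ESS (rate `1/W⁴`).
Nothing between the legs is assumed (union bound).  NOT CLAIMED: draws from the accepted chain;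
estimating `δ`, `C`, `W` or `∫ g² w` themselves (inputs here); sharper (Bernstein / empirical
variance) radii; the ESS threshold with `(e^{δ} − 1)·ESS'` in place of `e^{δ} − 1` (true, by the
same proof, but `ESS'` is itself estimated); unbounded observables; any number re-scored.
-/

noncomputable section

namespace Summit.Ventures.LatticeQCDFlow.Scoring.ParityLeg

open MeasureTheory ProbabilityTheory Finset Real Set
open Summit.Ventures.LatticeQCDFlow.Exactness

variable {Ω : Type*} [MeasurableSpace Ω] {P : Measure Ω} [IsProbabilityMeasure P] {ι : Type*}
variable {X : Type*} [MeasurableSpace X] {μ : Measure X} [SFinite μ]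

/-! ## §1 The `τ_int` column -/

/-- **THE `τ_int` COLUMN OF AN A-vs-B TABLE, CERTIFIED FROM ONE PARITY LEG.**  In the setting of
`Exactness.abs_tauInt_sub_le_of_logParityOff_of_weightBounds` (two weight-bounded flow samplers
`imhOp μ w q`, `imhOp μ w q'` at the common target weight `w`, parity `δ` off `E`, a centred bounded
observable `g` with `A = ∫ g² w > 0`), let `xᵢ`, `i ∈ s` (`n = #s ≥ 1`), be independent draws
from the model `q` and `Π̂ = Σ_{i∈s} 1_E(xᵢ)·w(xᵢ)/(Z q(xᵢ))` their importance-weighted failure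
sum (`Z = ∫ w`).  Then for every `t ≥ 0`:
`P( (e^{δ} − 1)(min(τ,τ') + ½) + e^{−δ}·4(B·max(C,C')/Z)²·(Z·(Π̂/n + t))/A < |τ − τ'| )
≤ exp(−2 n t² Z²/C²)`. -/
theorem tauInt_parityLeg_confidence {w q q' : X → ℝ} (hw0 : ∀ y, 0 < w y) (hwm : Measurable w)
    (hwi : Integrable w μ) (hq0 : ∀ y, 0 < q y) (hqm : Measurable q) (hqi : Integrable q μ)
    (hq1 : ∫ z, q z ∂μ = 1) (hq0' : ∀ y, 0 < q' y) (hqm' : Measurable q') (hqi' : Integrable q' μ)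
    (hq1' : ∫ z, q' z ∂μ = 1) {C C' : ℝ} (hC : ∀ y, w y ≤ C * q y) (hC' : ∀ y, w y ≤ C' * q' y)
    {E : Set X} (hE : MeasurableSet E) {δ : ℝ}
    (hlog : ∀ y, y ∉ E → |Real.log (q y) - Real.log (q' y)| ≤ δ) {g : X → ℝ} (hgm : Measurable g)
    {B : ℝ} (hgb : ∀ y, |g y| ≤ B) (hg0 : ∫ y, g y * w y ∂μ = 0) (hA : 0 < ∫ y, g y ^ 2 * w y ∂μ)
    {x : ι → Ω → X} (hind : iIndepFun x P) (hxm : ∀ i, Measurable (x i))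
    (hlaw : ∀ i, Measure.map (x i) P = μ.withDensity fun y => ENNReal.ofReal (q y))
    (s : Finset ι) (hs : 0 < s.card) {t : ℝ} (ht : 0 ≤ t) :
    P.real {ω | (Real.exp δ - 1)
          * (min (tauInt (fun k => (∫ y, g y * ((imhOp μ w q)^[k] g) y * w y ∂μ)
                / ∫ y, g y ^ 2 * w y ∂μ))
              (tauInt (fun k => (∫ y, g y * ((imhOp μ w q')^[k] g) y * w y ∂μ)
                / ∫ y, g y ^ 2 * w y ∂μ)) + 1 / 2)
          + Real.exp (-δ) * (4 * (B * (max C C' / ∫ z, w z ∂μ)) ^ 2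
              * ((∫ z, w z ∂μ)
                * ((∑ i ∈ s, E.indicator (fun y => w y / ((∫ z, w z ∂μ) * q y)) (x i ω)) / s.card
                  + t))) / ∫ y, g y ^ 2 * w y ∂μ
        < |tauInt (fun k => (∫ y, g y * ((imhOp μ w q)^[k] g) y * w y ∂μ) / ∫ y, g y ^ 2 * w y ∂μ)
            - tauInt (fun k => (∫ y, g y * ((imhOp μ w q')^[k] g) y * w y ∂μ)
                / ∫ y, g y ^ 2 * w y ∂μ)|}
      ≤ Real.exp (-(2 * s.card * t ^ 2 * (∫ z, w z ∂μ) ^ 2 / C ^ 2)) := by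
  obtain ⟨hZ, hCpos, -, -⟩ := rate_bounds hw0 hwi hq0 hqi hq1 hC
  have hlawτ := abs_tauInt_sub_le_of_logParityOff_of_weightBounds hw0 hwm hwi hq0 hqm hqi hq1 hq0'
    hqm' hqi' hq1' hC hC' hE hlog hgm hgb hg0 hA
  have hleg := targetMass_le_weightedFreq_confidence hind hxm hq0 hqm hlaw (fun y => (hw0 y).le)
    hwm hZ hC hE ht s
  have hn : (0 : ℝ) < s.card := by exact_mod_cast hs
  set Z : ℝ := ∫ z, w z ∂μ with hZdef
  set A : ℝ := ∫ y, g y ^ 2 * w y ∂μ with hAdef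
  set τ : ℝ := tauInt (fun k => (∫ y, g y * ((imhOp μ w q)^[k] g) y * w y ∂μ) / A)
  set τ' : ℝ := tauInt (fun k => (∫ y, g y * ((imhOp μ w q')^[k] g) y * w y ∂μ) / A)
  set Pw : Ω → ℝ := fun ω => ∑ i ∈ s, E.indicator (fun y => w y / (Z * q y)) (x i ω) with hPw
  have hsub : {ω | (Real.exp δ - 1) * (min τ τ' + 1 / 2)
          + Real.exp (-δ) * (4 * (B * (max C C' / Z)) ^ 2 * (Z * (Pw ω / s.card + t))) / A
        < |τ - τ'|}
      ⊆ {ω | Pw ω + s.card * t ≤ s.card * ((∫ y in E, w y ∂μ) / Z)} := by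
    intro ω hω
    simp only [mem_setOf_eq] at hω ⊢
    by_contra hcon
    have hlt : (∫ y in E, w y ∂μ) / Z < Pw ω / s.card + t := by
      rw [div_add' _ _ _ hn.ne', lt_div_iff₀ hn]; linarith [not_le.mp hcon]
    have hmass : ∫ y in E, w y ∂μ < Z * (Pw ω / s.card + t) := by
      rwa [div_lt_iff₀ hZ, mul_comm] at hlt
    -- the coefficient of the target mass in the deterministic law is nonnegative
    have hmono : Real.exp (-δ) * (4 * (B * (max C C' / Z)) ^ 2 * ∫ y in E, w y ∂μ) / A
        ≤ Real.exp (-δ) * (4 * (B * (max C C' / Z)) ^ 2 * (Z * (Pw ω / s.card + t))) / A :=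
      div_le_div_of_nonneg_right (mul_le_mul_of_nonneg_left
        (mul_le_mul_of_nonneg_left hmass.le (by positivity)) (Real.exp_pos _).le) hA.le
    linarith
  exact (measureReal_mono hsub).trans hleg

/-! ## §2 The ESS column -/

omit [SFinite μ] in
/-- A weight ceiling makes `p²/q` integrable: `0 ≤ p ≤ W q`, `q > 0`, `p` integrable and `p, q`
measurable ⇒ `∫ p²/q < ∞` (`p²/q = (p/q)·p ≤ W p`). [folklore] -/
theorem integrable_sq_div_of_weightBound {p q : X → ℝ} (hp0 : ∀ y, 0 ≤ p y) (hpm : Measurable p)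
    (hpi : Integrable p μ) (hq0 : ∀ y, 0 < q y) (hqm : Measurable q) {W : ℝ}
    (hW : ∀ y, p y ≤ W * q y) : Integrable (fun y => p y ^ 2 / q y) μ := by
  refine Integrable.mono' (hpi.const_mul W) ((hpm.pow_const 2).div hqm).aestronglyMeasurable
    (Filter.Eventually.of_forall fun y => ?_)
  rw [Real.norm_eq_abs, abs_of_nonneg (div_nonneg (sq_nonneg _) (hq0 y).le), sq,
    mul_div_assoc]
  calc p y * (p y / q y) ≤ p y * W :=
        mul_le_mul_of_nonneg_left (by rw [div_le_iff₀ (hq0 y)]; exact hW y) (hp0 y)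
    _ = W * p y := mul_comm _ _

omit [SFinite μ] in
/-- **THE ESS COLUMN OF AN A-vs-B TABLE, CERTIFIED FROM TWO PARITY LEGS.**  `p ≥ 0` a normalised
target density; `q, q' > 0` normalised model densities with weight ceilings `p ≤ W q`, `p ≤ W' q'`;
parity `|log q − log q'| ≤ δ` off a measurable `E`, `δ ≥ 0`; `ESS = (∫ p²/q)⁻¹`,
`ESS' = (∫ p²/q')⁻¹` the two reweighting effective-sample-size fractions.  LEGS: independent draws
`xᵢ` (`i ∈ s`, `n = #s ≥ 1`) from `q` with squared-weight failure sum `Σ̂ = Σ 1_E(xᵢ)(p/q)²(xᵢ)`,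
independent draws `x'ⱼ` (`j ∈ s'`, `n' ≥ 1`) from `q'` with `Σ̂'` likewise (nothing assumed
between the legs); `t, t' ≥ 0`.  Then
`P( (e^{δ} − 1) + (Σ̂/n + t) + (Σ̂'/n' + t') < |ESS − ESS'| ) ≤ exp(−2nt²/W⁴) + exp(−2n't'²/W'⁴)`. -/
theorem ess_parityLeg_confidence {p q q' : X → ℝ} (hp0 : ∀ y, 0 ≤ p y) (hpm : Measurable p)
    (hpi : Integrable p μ) (hp1 : ∫ y, p y ∂μ = 1) (hq0 : ∀ y, 0 < q y) (hqm : Measurable q)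
    (hqi : Integrable q μ) (hq1 : ∫ y, q y ∂μ = 1) (hq0' : ∀ y, 0 < q' y) (hqm' : Measurable q')
    (hqi' : Integrable q' μ) (hq1' : ∫ y, q' y ∂μ = 1) {W W' : ℝ} (hW : ∀ y, p y ≤ W * q y)
    (hW' : ∀ y, p y ≤ W' * q' y) {E : Set X} (hE : MeasurableSet E) {δ : ℝ} (hδ : 0 ≤ δ)
    (hlog : ∀ y, y ∉ E → |Real.log (q y) - Real.log (q' y)| ≤ δ)
    {x : ι → Ω → X} (hind : iIndepFun x P) (hxm : ∀ i, Measurable (x i))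
    (hlaw : ∀ i, Measure.map (x i) P = μ.withDensity fun y => ENNReal.ofReal (q y))
    {ι' : Type*} {x' : ι' → Ω → X} (hind' : iIndepFun x' P) (hxm' : ∀ j, Measurable (x' j))
    (hlaw' : ∀ j, Measure.map (x' j) P = μ.withDensity fun y => ENNReal.ofReal (q' y))
    (s : Finset ι) (s' : Finset ι') (hs : 0 < s.card) (hs' : 0 < s'.card) {t t' : ℝ}
    (ht : 0 ≤ t) (ht' : 0 ≤ t') :
    P.real {ω | (Real.exp δ - 1)
          + ((∑ i ∈ s, E.indicator (fun y => (p y / q y) ^ 2) (x i ω)) / s.card + t)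
          + ((∑ j ∈ s', E.indicator (fun y => (p y / q' y) ^ 2) (x' j ω)) / s'.card + t')
        < |(∫ y, p y ^ 2 / q y ∂μ)⁻¹ - (∫ y, p y ^ 2 / q' y ∂μ)⁻¹|}
      ≤ Real.exp (-(2 * s.card * t ^ 2 / W ^ 4)) + Real.exp (-(2 * s'.card * t' ^ 2 / W' ^ 4)) := by
  have hI := integrable_sq_div_of_weightBound hp0 hpm hpi hq0 hqm hW
  have hI' := integrable_sq_div_of_weightBound hp0 hpm hpi hq0' hqm' hW'
  have hlawE := TargetSideParityESS.abs_inv_integral_sq_div_sub_le_of_logParityOff hpi hp1 hq0 hqi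
    hq1 hq0' hqi' hq1' hI hI' hE hδ hlog
  have hM1' : 1 ≤ ∫ y, p y ^ 2 / q' y ∂μ :=
    TargetSideParityESS.one_le_integral_sq_div hpi hp1 hq0' hqi' hq1' hI'
  have hinv1' : (∫ y, p y ^ 2 / q' y ∂μ)⁻¹ ≤ 1 := inv_le_one_of_one_le₀ hM1'
  have hexp : 0 ≤ Real.exp δ - 1 := by linarith [Real.add_one_le_exp δ]
  have hA := sqWeightMass_le_weightedFreq_confidence hind hxm hq0 hqm hlaw hp0 hpm hW hE ht s
  have hA' := sqWeightMass_le_weightedFreq_confidence hind' hxm' hq0' hqm' hlaw' hp0 hpm hW' hE ht' s'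
  have hn : (0 : ℝ) < s.card := by exact_mod_cast hs
  have hn' : (0 : ℝ) < s'.card := by exact_mod_cast hs'
  set N : Ω → ℝ := fun ω => ∑ i ∈ s, E.indicator (fun y => (p y / q y) ^ 2) (x i ω) with hN
  set N' : Ω → ℝ := fun ω => ∑ j ∈ s', E.indicator (fun y => (p y / q' y) ^ 2) (x' j ω) with hN'
  have hsub : {ω | (Real.exp δ - 1) + (N ω / s.card + t) + (N' ω / s'.card + t')
        < |(∫ y, p y ^ 2 / q y ∂μ)⁻¹ - (∫ y, p y ^ 2 / q' y ∂μ)⁻¹|}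
      ⊆ {ω | N ω + s.card * t ≤ s.card * ∫ y in E, p y ^ 2 / q y ∂μ}
        ∪ {ω | N' ω + s'.card * t' ≤ s'.card * ∫ y in E, p y ^ 2 / q' y ∂μ} := by
    intro ω hω
    simp only [mem_setOf_eq, mem_union] at hω ⊢
    by_contra hcon
    obtain ⟨h1, h2⟩ := not_or.mp hcon
    have h1' : ∫ y in E, p y ^ 2 / q y ∂μ < N ω / s.card + t := by
      rw [div_add' _ _ _ hn.ne', lt_div_iff₀ hn]; linarith [not_le.mp h1]
    have h2' : ∫ y in E, p y ^ 2 / q' y ∂μ < N' ω / s'.card + t' := by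
      rw [div_add' _ _ _ hn'.ne', lt_div_iff₀ hn']; linarith [not_le.mp h2]
    have h3 : (Real.exp δ - 1) * (∫ y, p y ^ 2 / q' y ∂μ)⁻¹ ≤ Real.exp δ - 1 := by
      have := mul_le_mul_of_nonneg_left hinv1' hexp
      linarith
    linarith
  calc P.real {ω | (Real.exp δ - 1) + (N ω / s.card + t) + (N' ω / s'.card + t')
          < |(∫ y, p y ^ 2 / q y ∂μ)⁻¹ - (∫ y, p y ^ 2 / q' y ∂μ)⁻¹|}
      ≤ P.real ({ω | N ω + s.card * t ≤ s.card * ∫ y in E, p y ^ 2 / q y ∂μ}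
          ∪ {ω | N' ω + s'.card * t' ≤ s'.card * ∫ y in E, p y ^ 2 / q' y ∂μ}) :=
        measureReal_mono hsub
    _ ≤ P.real {ω | N ω + s.card * t ≤ s.card * ∫ y in E, p y ^ 2 / q y ∂μ}
          + P.real {ω | N' ω + s'.card * t' ≤ s'.card * ∫ y in E, p y ^ 2 / q' y ∂μ} :=
        measureReal_union_le _ _
    _ ≤ Real.exp (-(2 * s.card * t ^ 2 / W ^ 4)) + Real.exp (-(2 * s'.card * t' ^ 2 / W' ^ 4)) :=
        add_le_add hA hA'

end Summit.Ventures.LatticeQCDFlow.Scoring.ParityLeg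

end
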